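import Summits.AtomisticToContinuum.Crystallization.Theorems.SlackRigidity.Negative.WitnessTransitive

/-!
# `KeplerBound` (stmt-AtomisticToContinuum-11961) from bulk rigidity, I: witnesses of the hinge
# `BulkDefectVanish` tested on ground states

Support file for the item `ThreeConeCertificate.KeplerBound`.  The hinge `BulkDefectVanish`
(item stmt-AtomisticToContinuum-0751, shared by ten Crystallization routes) asserts that ONE
periodic configuration `P` of `ℝ³` is such that, along every sequence of Lennard-Jones ground
states, for every window radius `R` and tolerance `ε`, all but `o(N)` particles `i` have their
`R`-environment two-way `ε`-matched to `x i + A (P.points ∩ B_R)` for a linear isometry `A`.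

Here we isolate the weakest form of that hypothesis which the energy argument of part III uses:
"`P` is rigid along `gs`" — the matching conclusion `BadFractionVanishes P R ε gs` for all `R, ε > 0`
along the ONE canonical ground-state sequence `gs` (`LennardJonesGroundStatesExist_holds`); no new
definition is introduced.  `BulkDefectVanish`-witnesses and `SlackRigidity`-witnesses are rigid
along `gs` (`gsRigid_of_bulk`, `gsRigid_of_rigidFor`).  The necessary conditions proved in
`SlackRigidity/Negative/Witness*.lean` for `RigidFor` only ever used the sequence `gs`, so they
hold verbatim (proofs adapted from there):

* `zero_mem_points_of_gsRigid` — `0 ∈ P.points`;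
* `vertexTransitive_of_gsRigid` — for every `p₀ ∈ P.points` and every `(R, ε)` a linear isometry
  `B` two-way `ε`-matches `(P.points − p₀) ∩ B_R` with `B (P.points)`;
* `gsRigid_uniformlyDiscrete` — the points of a witness are `δ`-separated, `δ > 0` the uniform
  separation of Lennard-Jones ground states (tree: `1/3`), the same `δ` separating `gs`.

All `[folklore]`.
-/

noncomputable section

open scoped BigOperators Topology
open Filter Set Metric

namespace Summit.AtomisticToContinuum.Crystallization.Theorems.KeplerBoundBulk

open Literature.MathematicalPhysics.StatisticalMechanics
open Summit.AtomisticToContinuum.Crystallization.Theorems.SlackRigidityNegative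
open Summit.AtomisticToContinuum.Crystallization.Theses.ThreeConeCertificate
  (BulkDefectVanish SlackRigidity)

/-! ## § The hypothesis: rigidity tested on the canonical ground states

Throughout, the hypothesis on `P` is
`hP : ∀ R ε : ℝ, 0 < R → 0 < ε → BadFractionVanishes P R ε gs` — the matching conclusion of the
hinge along the canonical ground-state sequence `gs` (no new definition is introduced; `Good`,
`badCount`, `BadFractionVanishes`, `gs` are those of `SlackRigidity/Negative/WitnessBasics.lean`). -/

/-- A `BulkDefectVanish`-witness `P` (the hinge's inner statement for `P`) is rigid along the
canonical ground states `gs`. [folklore] -/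
theorem gsRigid_of_bulk {P : PeriodicConfiguration 3}
    (hP : ∀ R ε : ℝ, 0 < R → 0 < ε → ∀ x : (N : ℕ) → Fin N → E3,
      (∀ N, IsGroundState lennardJones (x N)) → BadFractionVanishes P R ε x) :
    ∀ R ε : ℝ, 0 < R → 0 < ε → BadFractionVanishes P R ε gs :=
  fun R ε hR hε => hP R ε hR hε gs gs_isGroundState

/-- `BulkDefectVanish` provides a periodic configuration rigid along `gs`. [folklore] -/
theorem exists_gsRigid_of_bulkDefectVanish (h : BulkDefectVanish) :
    ∃ P : PeriodicConfiguration 3, ∀ R ε : ℝ, 0 < R → 0 < ε → BadFractionVanishes P R ε gs :=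
  let ⟨P, hP⟩ := h
  ⟨P, gsRigid_of_bulk hP⟩

/-- A `SlackRigidity`-witness is rigid along `gs` (ground states are injective with zero
excess). [folklore] -/
theorem gsRigid_of_rigidFor {P : PeriodicConfiguration 3} (hP : RigidFor P) :
    ∀ R ε : ℝ, 0 < R → 0 < ε → BadFractionVanishes P R ε gs :=
  fun R ε hR hε => hP R ε hR hε gs gs_injective excessVanishes_gs

/-- `SlackRigidity` provides a periodic configuration rigid along `gs`. [folklore] -/
theorem exists_gsRigid_of_slackRigidity (h : SlackRigidity) :
    ∃ P : PeriodicConfiguration 3, ∀ R ε : ℝ, 0 < R → 0 < ε → BadFractionVanishes P R ε gs :=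
  let ⟨P, hP⟩ := h
  ⟨P, gsRigid_of_rigidFor hP⟩

/-! ## § Necessary conditions on a witness -/

/-- If no point of `P` lies within `ε` of the origin, every particle of every configuration is
bad at tolerance `ε` (clause (b) with `j = i`). [folklore] -/
theorem forall_bad_of_far {P : PeriodicConfiguration 3} {ε R : ℝ} (hR : 0 ≤ R)
    (hfar : ∀ q ∈ P.points, ε < ‖q‖) {N : ℕ} (x : Fin N → E3) (i : Fin N) :
    ¬ Good P R ε x i := by
  rintro ⟨A, -, h2⟩
  obtain ⟨q, hq, hqi⟩ := h2 i (by simp [hR])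
  rw [dist_comm, dist_add_linearIsometry] at hqi
  have := hfar q hq
  linarith

/-- **A witness contains the origin.** [folklore] -/
theorem zero_mem_points_of_gsRigid {P : PeriodicConfiguration 3}
    (hP : ∀ R ε : ℝ, 0 < R → 0 < ε → BadFractionVanishes P R ε gs) :
    (0 : E3) ∈ P.points := by
  by_contra h0
  have hfin : (closedBall (0 : E3) 1 ∩ P.points).Finite := P.finite_inter_points isBounded_closedBall
  have hopen : IsOpen (closedBall (0 : E3) 1 ∩ P.points)ᶜ := hfin.isClosed.isOpen_compl
  have hmem : (0 : E3) ∈ (closedBall (0 : E3) 1 ∩ P.points)ᶜ := fun h => h0 h.2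
  obtain ⟨ε₀, hε₀, hball⟩ := Metric.mem_nhds_iff.1 (hopen.mem_nhds hmem)
  obtain ⟨ε, hε, hε1, hε2⟩ : ∃ ε : ℝ, 0 < ε ∧ ε ≤ ε₀ / 2 ∧ ε ≤ 1 / 2 :=
    ⟨min (ε₀ / 2) (1 / 2), lt_min (by linarith) (by norm_num), min_le_left _ _, min_le_right _ _⟩
  have hfar : ∀ q ∈ P.points, ε < ‖q‖ := by
    intro q hq
    by_contra hle
    rw [not_lt] at hle
    have hq1 : q ∈ closedBall (0 : E3) 1 := by
      rw [mem_closedBall, dist_zero_right]; linarith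
    have hq2 : q ∈ ball (0 : E3) ε₀ := by
      rw [mem_ball, dist_zero_right]; linarith
    exact hball hq2 ⟨hq1, hq⟩
  exact not_badFractionVanishes_of_forall_bad
    (fun N i => forall_bad_of_far zero_le_one hfar (gs N) i) (hP 1 ε one_pos hε)

/-- **A witness has no point in the punctured `δ`-ball about `0`**, `δ > 0` the uniform
separation of Lennard-Jones ground states. [folklore] -/
theorem le_norm_of_gsRigid :
    ∃ δ : ℝ, 0 < δ ∧ (∀ N (i j : Fin N), i ≠ j → δ ≤ dist (gs N i) (gs N j)) ∧
      ∀ P : PeriodicConfiguration 3,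
        (∀ R ε : ℝ, 0 < R → 0 < ε → BadFractionVanishes P R ε gs) →
          ∀ p ∈ P.points, p ≠ 0 → δ ≤ ‖p‖ := by
  obtain ⟨δ, hδ, hsep⟩ := gs_separated
  refine ⟨δ, hδ, hsep, fun P hP p hp hp0 => ?_⟩
  by_contra hlt
  rw [not_le] at hlt
  have hpn : 0 < ‖p‖ := norm_pos_iff.2 hp0
  obtain ⟨ε, hε, hε1, hε2⟩ : ∃ ε : ℝ, 0 < ε ∧ ε ≤ ‖p‖ / 2 ∧ ε ≤ (δ - ‖p‖) / 2 :=
    ⟨min (‖p‖ / 2) ((δ - ‖p‖) / 2), lt_min (by linarith) (by linarith), min_le_left _ _,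
      min_le_right _ _⟩
  have hbad : ∀ N (i : Fin N), ¬ Good P ‖p‖ ε (gs N) i := by
    rintro N i ⟨A, h1, -⟩
    obtain ⟨j, hj⟩ := h1 p hp le_rfl
    by_cases hji : j = i
    · subst hji
      rw [dist_comm, dist_add_linearIsometry] at hj
      linarith
    · have h3 : δ ≤ dist (gs N j) (gs N i) := hsep N j i hji
      have h4 : dist (gs N j) (gs N i) ≤ dist (gs N j) (gs N i + A p) + ‖p‖ :=
        calc dist (gs N j) (gs N i)
            ≤ dist (gs N j) (gs N i + A p) + dist (gs N i + A p) (gs N i) := dist_triangle _ _ _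
          _ = dist (gs N j) (gs N i + A p) + ‖p‖ := by rw [dist_add_linearIsometry]
      linarith
  exact not_badFractionVanishes_of_forall_bad hbad (hP ‖p‖ ε hpn hε)

/-- **A witness is vertex-transitive up to linear isometries, at every tolerance**: for every
`p₀ ∈ P.points` and every `(R, ε)` there is a linear isometry `B` with `(P.points − p₀) ∩ B_R`
two-way `ε`-matched to `B (P.points)` (a good particle of a large ground state whose
`p₀`-neighbour is also good exists by a packing count; compare the two matchings).
Adapted from `rigidFor_vertexTransitive`. [folklore] -/
theorem vertexTransitive_of_gsRigid {P : PeriodicConfiguration 3}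
    (hP : ∀ R ε : ℝ, 0 < R → 0 < ε → BadFractionVanishes P R ε gs) {p₀ : E3}
    (hp₀ : p₀ ∈ P.points) {R ε : ℝ} (hR : 0 < R) (hε : 0 < ε) :
    ∃ B : E3 →ₗᵢ[ℝ] E3,
      (∀ q ∈ P.points, ‖q‖ ≤ R → ∃ q' ∈ P.points, dist q' (p₀ + B q) ≤ ε) ∧
      (∀ q' ∈ P.points, dist q' p₀ ≤ R → ∃ q ∈ P.points, dist q' (p₀ + B q) ≤ ε) := by
  classical
  obtain ⟨δ, hδ, hsep⟩ := gs_separated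
  obtain ⟨ε₁, hε₁, hε₁ε, hε₁1⟩ : ∃ ε₁ : ℝ, 0 < ε₁ ∧ 3 * ε₁ ≤ ε ∧ 2 * ε₁ ≤ 1 :=
    ⟨min (ε / 3) (1 / 2), lt_min (by linarith) (by norm_num),
      by linarith [min_le_left (ε / 3) (1 / 2 : ℝ)], by linarith [min_le_right (ε / 3) (1 / 2 : ℝ)]⟩
  set R₁ : ℝ := ‖p₀‖ + R + 1 with hR₁
  have hR₁pos : 0 < R₁ := by positivity
  have hfew : FewBad fun N i => Good P R₁ ε₁ (gs N) i := hP R₁ ε₁ hR₁pos hε₁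
  set C : ℝ := (2 * (‖p₀‖ + ε₁) / δ + 1) ^ Module.finrank ℝ E3 with hC
  have hCpos : 0 < C := by positivity
  set c : ℝ := 1 / (2 * (C + 1)) with hc
  have hcpos : 0 < c := by positivity
  obtain ⟨N, hlt, hN1⟩ := ((hfew.eventually_lt hcpos).and (eventually_ge_atTop 1)).exists
  haveI : Nonempty (Fin N) := ⟨⟨0, hN1⟩⟩
  haveI : Nonempty (E3 →ₗᵢ[ℝ] E3) := ⟨LinearIsometry.id⟩
  set x := gs N with hx
  have hxinj : Function.Injective x := gs_injective N
  have hxsep : ∀ a a' : Fin N, a ≠ a' → δ ≤ dist (x a) (x a') := hsep N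
  have hchoice : ∀ i : Fin N, Good P R₁ ε₁ x i → ∃ A : E3 →ₗᵢ[ℝ] E3, ∃ j : Fin N,
      (∀ p ∈ P.points, ‖p‖ ≤ R₁ → ∃ k : Fin N, dist (x k) (x i + A p) ≤ ε₁) ∧
      (∀ k : Fin N, dist (x k) (x i) ≤ R₁ → ∃ p ∈ P.points, dist (x k) (x i + A p) ≤ ε₁) ∧
      dist (x j) (x i + A p₀) ≤ ε₁ := by
    rintro i ⟨A, ha, hb⟩
    obtain ⟨j, hj⟩ := ha p₀ hp₀ (by rw [hR₁]; linarith)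
    exact ⟨A, j, ha, hb, hj⟩
  choose! A j hA hB hj using hchoice
  set G := Finset.univ.filter fun i => Good P R₁ ε₁ x i with hG
  set Bd := Finset.univ.filter fun i => ¬ Good P R₁ ε₁ x i with hBd
  have hBd_card : (Bd.card : ℝ) < c * N := by
    have e : Nat.card {i : Fin N // ¬ Good P R₁ ε₁ x i} = Bd.card := by
      rw [Nat.card_eq_fintype_card, Fintype.card_subtype]
    have := hlt
    rw [e] at this
    exact this
  have hGB : (G.card : ℝ) + Bd.card = N := by
    have := Finset.card_filter_add_card_filter_not
      (s := (Finset.univ : Finset (Fin N))) (fun i => Good P R₁ ε₁ x i)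
    rw [Finset.card_univ, Fintype.card_fin] at this
    exact_mod_cast this
  have hexists : ∃ i ∈ G, j i ∈ G := by
    by_contra hno
    have hmaps : ∀ i ∈ G, j i ∈ Bd := by
      intro i hi
      rw [hBd, Finset.mem_filter]
      refine ⟨Finset.mem_univ _, fun hgood => hno ⟨i, hi, ?_⟩⟩
      rw [hG, Finset.mem_filter]
      exact ⟨Finset.mem_univ _, hgood⟩
    have hfib : ∀ b ∈ Bd, ((G.filter fun a => j a = b).card : ℝ) ≤ C := by
      intro b _
      have hcard : (((G.filter fun a => j a = b).image x).card : ℝ) =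
          (G.filter fun a => j a = b).card := by
        rw [Finset.card_image_of_injective _ hxinj]
      rw [← hcard, hC]
      refine card_le_of_separated_of_dist_le ((G.filter fun a => j a = b).image x) (x b) hδ
        (by positivity) ?_ ?_
      · intro cpt hcpt
        obtain ⟨a, ha, rfl⟩ := Finset.mem_image.1 hcpt
        have haG : a ∈ G := (Finset.mem_filter.1 ha).1
        have hja : j a = b := (Finset.mem_filter.1 ha).2
        have hgood : Good P R₁ ε₁ x a := (Finset.mem_filter.1 haG).2
        have hd := hj a hgood
        rw [hja] at hd
        calc dist (x a) (x b) = dist (x b) (x a) := dist_comm _ _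
          _ ≤ dist (x b) (x a + A a p₀) + dist (x a + A a p₀) (x a) := dist_triangle _ _ _
          _ ≤ ε₁ + ‖p₀‖ := by rw [dist_add_linearIsometry]; linarith
          _ = ‖p₀‖ + ε₁ := by ring
      · intro cpt hcpt dpt hdpt hne
        obtain ⟨a, -, rfl⟩ := Finset.mem_image.1 hcpt
        obtain ⟨a', -, rfl⟩ := Finset.mem_image.1 hdpt
        exact hxsep a a' (fun h => hne (by rw [h]))
    have hsum : (G.card : ℝ) ≤ Bd.card * C := by
      have h1 : G.card = ∑ b ∈ Bd, (G.filter fun a => j a = b).card :=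
        Finset.card_eq_sum_card_fiberwise hmaps
      have h2 : (G.card : ℝ) = ∑ b ∈ Bd, ((G.filter fun a => j a = b).card : ℝ) := by
        rw [h1]; exact Nat.cast_sum _ _
      rw [h2]
      calc ∑ b ∈ Bd, ((G.filter fun a => j a = b).card : ℝ) ≤ ∑ b ∈ Bd, C :=
            Finset.sum_le_sum hfib
        _ = Bd.card * C := by rw [Finset.sum_const, nsmul_eq_mul]
    have hN : (1 : ℝ) ≤ N := by exact_mod_cast hN1
    have h3 : (N : ℝ) ≤ (C + 1) * Bd.card := by linarith
    have h4 : (C + 1) * (Bd.card : ℝ) < (C + 1) * (c * N) :=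
      mul_lt_mul_of_pos_left hBd_card (by positivity)
    have hC1 : (C + 1) ≠ 0 := by positivity
    have hcC : (C + 1) * (c * N) = N / 2 := by
      rw [hc]; field_simp
    linarith
  obtain ⟨i, hiG, hjG⟩ := hexists
  have hgi : Good P R₁ ε₁ x i := (Finset.mem_filter.1 hiG).2
  have hgj : Good P R₁ ε₁ x (j i) := (Finset.mem_filter.1 hjG).2
  have hy : dist (x (j i)) (x i + A i p₀) ≤ ε₁ := hj i hgi
  have hyi : dist (x (j i)) (x i) ≤ ε₁ + ‖p₀‖ :=
    calc dist (x (j i)) (x i) ≤ dist (x (j i)) (x i + A i p₀) + dist (x i + A i p₀) (x i) :=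
          dist_triangle _ _ _
      _ ≤ ε₁ + ‖p₀‖ := by rw [dist_add_linearIsometry]; linarith
  refine ⟨conj (A i) (A (j i)), fun q hq hqR => ?_, fun q' hq' hq'R => ?_⟩
  · obtain ⟨k, hk⟩ := hA (j i) hgj q hq (by rw [hR₁]; linarith [norm_nonneg p₀])
    have hki : dist (x k) (x i) ≤ R₁ :=
      calc dist (x k) (x i)
          ≤ dist (x k) (x (j i) + A (j i) q) + dist (x (j i) + A (j i) q) (x (j i)) +
            dist (x (j i)) (x i) := dist_triangle4 _ _ _ _
        _ ≤ ε₁ + ‖q‖ + (ε₁ + ‖p₀‖) := by rw [dist_add_linearIsometry]; linarith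
        _ ≤ R₁ := by rw [hR₁]; linarith
    obtain ⟨q'', hq'', hkq''⟩ := hB i hgi k hki
    refine ⟨q'', hq'', ?_⟩
    rw [dist_conj]
    calc dist (A i q'') (A i p₀ + A (j i) q)
        = dist (x i + A i q'') (x i + A i p₀ + A (j i) q) := by rw [add_assoc, dist_add_left]
      _ ≤ dist (x i + A i q'') (x k) + dist (x k) (x (j i) + A (j i) q) +
            dist (x (j i) + A (j i) q) (x i + A i p₀ + A (j i) q) := dist_triangle4 _ _ _ _
      _ ≤ ε₁ + ε₁ + ε₁ := by
          rw [dist_add_right, dist_comm (x i + A i q'')]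
          linarith
      _ ≤ ε := by linarith
  · have hq'norm : ‖q'‖ ≤ R₁ :=
      calc ‖q'‖ = ‖(q' - p₀) + p₀‖ := by rw [sub_add_cancel]
        _ ≤ ‖q' - p₀‖ + ‖p₀‖ := norm_add_le _ _
        _ = dist q' p₀ + ‖p₀‖ := by rw [dist_eq_norm]
        _ ≤ R₁ := by rw [hR₁]; linarith
    obtain ⟨k, hk⟩ := hA i hgi q' hq' hq'norm
    have hkj : dist (x k) (x (j i)) ≤ R₁ :=
      calc dist (x k) (x (j i))
          ≤ dist (x k) (x i + A i q') + dist (x i + A i q') (x i + A i p₀) +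
            dist (x i + A i p₀) (x (j i)) := dist_triangle4 _ _ _ _
        _ ≤ ε₁ + R + ε₁ := by
            rw [dist_add_left, LinearIsometry.dist_map, dist_comm (x i + A i p₀)]
            linarith
        _ ≤ R₁ := by rw [hR₁]; linarith [norm_nonneg p₀]
    obtain ⟨q, hq, hkq⟩ := hB (j i) hgj k hkj
    refine ⟨q, hq, ?_⟩
    rw [dist_conj]
    calc dist (A i q') (A i p₀ + A (j i) q)
        = dist (x i + A i q') (x i + A i p₀ + A (j i) q) := by rw [add_assoc, dist_add_left]
      _ ≤ dist (x i + A i q') (x k) + dist (x k) (x (j i) + A (j i) q) +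
            dist (x (j i) + A (j i) q) (x i + A i p₀ + A (j i) q) := dist_triangle4 _ _ _ _
      _ ≤ ε₁ + ε₁ + ε₁ := by
          rw [dist_add_right, dist_comm (x i + A i q')]
          linarith
      _ ≤ ε := by linarith

/-- **A witness is uniformly discrete with the ground-state separation `δ`**, and the same `δ`
separates the canonical ground states. [folklore] -/
theorem gsRigid_uniformlyDiscrete : ∃ δ : ℝ, 0 < δ ∧
    (∀ N (i j : Fin N), i ≠ j → δ ≤ dist (gs N i) (gs N j)) ∧
    ∀ P : PeriodicConfiguration 3,
      (∀ R ε : ℝ, 0 < R → 0 < ε → BadFractionVanishes P R ε gs) →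
        ∀ p ∈ P.points, ∀ q ∈ P.points, p ≠ q → δ ≤ dist p q := by
  obtain ⟨δ, hδ, hsep, hall⟩ := le_norm_of_gsRigid
  refine ⟨δ, hδ, hsep, fun P hP p hp q hq hpq => ?_⟩
  by_contra hlt
  rw [not_le] at hlt
  have hd : 0 < dist p q := dist_pos.2 hpq
  obtain ⟨ε, hε, hε1, hε2⟩ : ∃ ε : ℝ, 0 < ε ∧ ε ≤ dist p q / 3 ∧ ε ≤ (δ - dist p q) / 3 :=
    ⟨min (dist p q / 3) ((δ - dist p q) / 3), lt_min (by linarith) (by linarith), min_le_left _ _,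
      min_le_right _ _⟩
  obtain ⟨B, -, hb⟩ := vertexTransitive_of_gsRigid hP hq hd hε
  obtain ⟨q₀, hq₀, hpq₀⟩ := hb p hp le_rfl
  have hnorm : dist (q + B q₀) q = ‖q₀‖ := dist_add_linearIsometry B q q₀
  by_cases h0 : q₀ = 0
  · subst h0
    rw [map_zero, add_zero] at hpq₀
    linarith
  · have h1 := hall P hP q₀ hq₀ h0
    have h2 : ‖q₀‖ ≤ dist p q + ε := by
      rw [← hnorm]
      calc dist (q + B q₀) q ≤ dist (q + B q₀) p + dist p q := dist_triangle _ _ _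
        _ ≤ ε + dist p q := by rw [dist_comm] at hpq₀; linarith
        _ = dist p q + ε := by ring
    linarith

end Summit.AtomisticToContinuum.Crystallization.Theorems.KeplerBoundBulk

end
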